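import Summits.HodgeConjecture.CorCM.IrreducibleOddWeightsCommutantDensityMeet
import Summits.HodgeConjecture.CorCM.IrreducibleOddWeightsIndexParity
import Mathlib.RingTheory.Finiteness.Lattice
import HarnessLib

/-!
# Density over the commutant, IX: HODGE DOMINATION — `rank(Φ₀,Φ₁) = rank Φ₀` IFF `MC₁ ≤ MC₀` IFF `MC₁ ≤ S(w₀)`
# IFF, inside an isotypic class, the D-span of the components of `u₁` lies in that of `w₀`

COR-CM (cell `pub-hodgecm2`, binder seat `b16` gen 73, count-neutral claim THE BICOMMUTANT AND HODGE DOMINATION,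
file K3 — abstract `G`-set level and type ranks; theorems only, no definition, no named fact, no `sorry`).  NEW as
stated, hence under `Summits/`.  HONEST FRAMING: finite-dimensional linear algebra about the Kubota–Dodson rank of a
family of CM types, read on the Mumford–Tate groups of products of abelian varieties with complex multiplication:
`rank Σ − 1 = dim MT(∏ A_i)/𝔾_m = dim Hg(∏ A_i)` and `rank Φ_i − 1 = dim Hg(A_i)` (Pohlmann; Deligne's Ex. 3.7).
**`rank Σ = rank Φ_{i₀}`** says that the projection `MT(∏_i A_i) → MT(A_{i₀})` is an ISOGENY — every `A_i` is
HODGE-DOMINATED by `A_{i₀}` (its Hodge structure lies in the tensor category generated by that of `A_{i₀}`); on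
character groups (`MC_i = X^*(MT(A_i))_ℚ` inside `ℚ^G`, gen 64 R1) this is `MC_i ⊆ MC_{i₀}`.  Nothing is claimed
about the algebraicity of Hodge classes; `HC_CM` is neither used nor asserted.

* §1 (no irreducibility) **MONOTONICITY `rank Φ_i ≤ rank Σ`** (`typeRank_le_typeRank_sigmaType`) and **DOMINATION
  `rank Σ = rank Φ_{i₀} ⟺ ∀ i, MC_i ≤ MC_{i₀}`** (`typeRank_sigmaType_eq_typeRank_iff_forall_span_coeff_le`); for a
  pair `⟺ MC₁ ≤ MC₀`, with the count **`rank(Φ₀,Φ₁) + dim(MC₀ ∩ MC₁) = rank Φ₀ + dim MC₁`**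
  (`typeRank_sigmaType_add_finrank_inf_eq_of_pair`: the EXCESS `dim Hg(A₀×A₁) − dim Hg(A₀)` is `dim MC₁ −
  dim(MC₀ ∩ MC₁)`).
* §2 PIVOTS.  For a pivot `r₀` of slot `0` refining the trace classes: **`MC₁ ≤ MC₀ ⟺ MC₁ ≤ F₀^{r₀}`**
  (`span_coeff_le_iff_le_span_fibreSum_of_fine`; gen 68 P1: `MC₀ ∩ MC₁ = F₀ ∩ MC₁`), `= S(w₀)` for `r₀` equivariant;
  with fine pivots on BOTH slots, domination forces the dominated pivot to be FAITHFUL: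
  **`rank(Φ₀,Φ₁) = rank Φ₀ ⟺ F₁ = MC₁ ∧ F₁ ≤ F₀`** (`typeRank_sigmaType_eq_typeRank_iff_of_fine_of_fine`).
* §3 IN AN ISOTYPIC CLASS (file C6): `w₀ = Σ_j ι⁰_j(b_j)` (shadow of `Φ₀` on the equivariant fine pivot `Y₀`) and the
  TYPE VECTOR ITSELF `u₁ = Σ_k ι¹_k(b′_k)` (Galois pivot of slot `1`) assembled from ONE reference stable irreducible
  `A` with commutant `𝒟`: **`rank(Φ₀,Φ₁) = rank Φ₀ ⟺ D⟨b′⟩ ≤ D⟨b⟩`**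
  (`typeRank_sigmaType_eq_typeRank_iff_iSup_le_of_class`); one component per side **`⟺ b′ ∈ D·b`**; and THE EXCESS
  COUNT **`rank(Φ₀,Φ₁)·δ + dim(D⟨b⟩ ∩ D⟨b′⟩)·dim A = rank Φ₀·δ + dim D⟨b′⟩·dim A`**
  (`typeRank_sigmaType_mul_add_eq_of_class`): `(dim Hg(A₀×A₁) − dim Hg(A₀))·δ = dim_ℚ(D⟨b′⟩/(D⟨b⟩ ∩ D⟨b′⟩))·dim A`.
File K4 (`…CommutantDominationCMFields`) is the CM dress.

## References

* [Deligne1982HodgeCycles] P. Deligne, *Hodge cycles on abelian varieties*, LNM 900 (1982), I.3.4, I.5 (p. 53),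
  I Ex. 3.7.
* [Gordon1999HodgeAVSurvey] B. B. Gordon, *A survey of the Hodge conjecture for abelian varieties*, §3 Theorem (Imai,
  Murty) with proof, 7.5–7.7, 9.4.3.
* [Ribet1980] K. A. Ribet, *Division fields of abelian varieties with complex multiplication*, Mém. SMF 2 (1980),
  §3 (3.3).
* [Lang2002] S. Lang, *Algebra*, 3rd ed., XVII §3.
-/

set_option autoImplicit false

noncomputable section

open scoped BigOperators Classical

universe u u₀ u₁ v v' v'' vY w

namespace Summit.HodgeConjecture.CorCM.IrrOdd

open Literature.NumberTheory.ComplexMultiplication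

variable {G : Type w} [Group G] {I : Type u} {E : I → Type v} [∀ i, MulAction G (E i)] [∀ i, Fintype (E i)]
  [Fintype I] [∀ i, Nonempty (E i)]

/-! ### §1 Monotonicity and domination at the level of matrix-coefficient spaces -/

/-- **MONOTONICITY: `rank Φ_i ≤ rank Σ`** (`dim Hg(A_i) ≤ dim Hg(∏_j A_j)`: `MC_i ≤ ⨆_j MC_j` in `ℚ^G`).
[cite: Deligne1982HodgeCycles, I.5 (p. 53) and I Ex. 3.7 (c)] [cite: Gordon1999HodgeAVSurvey, 7.7] -/
theorem typeRank_le_typeRank_sigmaType {ρ : G} {Φ : ∀ i, Set (E i)} (h : ∀ i, IsCMTypeWith ρ (Φ i)) (i : I) :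
    typeRank G (Φ i) ≤ typeRank G (sigmaType Φ) := by
  haveI : Nonempty I := ⟨i⟩
  haveI : Nonempty (Σ i, E i) := ⟨⟨i, Classical.arbitrary (E i)⟩⟩
  haveI := fun j => finite_span_coeff (G := G) (Φ j)
  rw [(IsCMTypeWith.sigmaType h).typeRank_eq_finrank_antiSpan_add_one, (h i).typeRank_eq_finrank_antiSpan_add_one,
    finrank_antiSpan_sigmaType_eq_finrank_iSup_span_coeff, finrank_antiSpan_eq_finrank_span_coeff]
  exact Nat.add_le_add_right (Submodule.finrank_mono
    (le_iSup (fun j => Submodule.span ℚ (Set.range fun x : E j => fun g : G => antiVec (Φ j) g x)) i)) 1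

/-- **HODGE DOMINATION: `rank Σ = rank Φ_{i₀} ⟺ MC_i ≤ MC_{i₀}` for every `i`** — `MT(∏_i A_i) → MT(A_{i₀})` is
an isogeny iff every `X^*(MT(A_i))_ℚ` lies in `X^*(MT(A_{i₀}))_ℚ` inside `ℚ^G`.
[cite: Deligne1982HodgeCycles, I.5 (p. 53) and I Ex. 3.7 (c)] [cite: Gordon1999HodgeAVSurvey, §3 Theorem (proof), 7.7] -/
theorem typeRank_sigmaType_eq_typeRank_iff_forall_span_coeff_le {ρ : G} {Φ : ∀ i, Set (E i)}
    (h : ∀ i, IsCMTypeWith ρ (Φ i)) (i₀ : I) :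
    typeRank G (sigmaType Φ) = typeRank G (Φ i₀) ↔
      ∀ i, Submodule.span ℚ (Set.range fun x : E i => fun g : G => antiVec (Φ i) g x) ≤
        Submodule.span ℚ (Set.range fun x : E i₀ => fun g : G => antiVec (Φ i₀) g x) := by
  haveI : Nonempty I := ⟨i₀⟩
  haveI : Nonempty (Σ i, E i) := ⟨⟨i₀, Classical.arbitrary (E i₀)⟩⟩
  haveI := fun j => finite_span_coeff (G := G) (Φ j)
  set C : I → Submodule ℚ (G → ℚ) := fun j =>
    Submodule.span ℚ (Set.range fun x : E j => fun g : G => antiVec (Φ j) g x) with hC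
  rw [(IsCMTypeWith.sigmaType h).typeRank_eq_finrank_antiSpan_add_one, (h i₀).typeRank_eq_finrank_antiSpan_add_one,
    finrank_antiSpan_sigmaType_eq_finrank_iSup_span_coeff, finrank_antiSpan_eq_finrank_span_coeff, Nat.add_right_cancel_iff]
  change Module.finrank ℚ ↥(⨆ i, C i) = Module.finrank ℚ ↥(C i₀) ↔ ∀ i, C i ≤ C i₀
  constructor
  · intro hfin i
    have heq : C i₀ = ⨆ j, C j := Submodule.eq_of_le_of_finrank_eq (le_iSup C i₀) hfin.symm
    rw [heq]
    exact le_iSup C i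
  · intro hle
    rw [le_antisymm (iSup_le hle) (le_iSup C i₀)]

/-- Domination for a PAIR: **`rank(Φ₀,Φ₁) = rank Φ₀ ⟺ MC₁ ≤ MC₀`** (`MT(A₀ × A₁) → MT(A₀)` an isogeny: `A₁` is
Hodge-dominated by `A₀`). [cite: Deligne1982HodgeCycles, I.5 (p. 53)] [cite: Gordon1999HodgeAVSurvey, §3 Theorem
(proof), 7.5–7.7] -/
theorem typeRank_sigmaType_eq_typeRank_iff_span_coeff_le_of_pair {ρ : G} {Φ : ∀ i, Set (E i)}
    (h : ∀ i, IsCMTypeWith ρ (Φ i)) {i₀ i₁ : I} (hI : ∀ j, j = i₀ ∨ j = i₁) :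
    typeRank G (sigmaType Φ) = typeRank G (Φ i₀) ↔
      Submodule.span ℚ (Set.range fun x : E i₁ => fun g : G => antiVec (Φ i₁) g x) ≤
        Submodule.span ℚ (Set.range fun x : E i₀ => fun g : G => antiVec (Φ i₀) g x) := by
  rw [typeRank_sigmaType_eq_typeRank_iff_forall_span_coeff_le h i₀]
  refine ⟨fun hle => hle i₁, fun hle i => ?_⟩
  rcases hI i with rfl | rfl
  · exact le_rfl
  · exact hle

/-- **THE EXCESS OF A PAIR OVER ITS FIRST MEMBER: `rank(Φ₀,Φ₁) + dim(MC₀ ∩ MC₁) = rank Φ₀ + dim MC₁`**, i.e.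
`dim Hg(A₀ × A₁) − dim Hg(A₀) = dim MC₁ − dim(MC₀ ∩ MC₁)` (gen 64 R1's pair defect together with
`rank Φ₁ = dim MC₁ + 1`). [cite: Deligne1982HodgeCycles, I.5 (p. 53)] [cite: Ribet1980, §3 (3.3)]
[cite: Gordon1999HodgeAVSurvey, §3 Theorem (proof), 7.5–7.7] -/
theorem typeRank_sigmaType_add_finrank_inf_eq_of_pair {ρ : G} {Φ : ∀ i, Set (E i)}
    (h : ∀ i, IsCMTypeWith ρ (Φ i)) {i₀ i₁ : I} (hI : ∀ j, j = i₀ ∨ j = i₁) (h01 : i₀ ≠ i₁) :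
    typeRank G (sigmaType Φ) +
        Module.finrank ℚ ↥(Submodule.span ℚ (Set.range fun x : E i₀ => fun g : G => antiVec (Φ i₀) g x) ⊓
          Submodule.span ℚ (Set.range fun x : E i₁ => fun g : G => antiVec (Φ i₁) g x)) =
      typeRank G (Φ i₀) +
        Module.finrank ℚ ↥(Submodule.span ℚ (Set.range fun x : E i₁ => fun g : G => antiVec (Φ i₁) g x)) := by
  have hpair := typeRank_add_typeRank_eq_of_pair h hI h01
  rw [(h i₁).typeRank_eq_finrank_antiSpan_add_one, finrank_antiSpan_eq_finrank_span_coeff] at hpair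
  omega

/-! ### §2 Pivots -/

section Pivot

variable {Y₀ : Type v'} {Y₁ : Type v''}

omit [Fintype I] [∀ i, Nonempty (E i)] in
/-- **`MC₁ ≤ MC₀ ⟺ MC₁ ≤ F₀^{r}`** for every pivot `r` of slot `0` refining the trace classes (`F₀ ≤ MC₀` always;
`MC₀ ∩ MC₁ = F₀ ∩ MC₁`, gen 68 P1). [cite: Gordon1999HodgeAVSurvey, §3 Theorem (proof)] -/
theorem span_coeff_le_iff_le_span_fibreSum_of_fine (Φ : ∀ i, Set (E i)) {i₀ i₁ : I} (r : E i₀ → Y₀)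
    (hfine : ∀ x x' : E i₀, r x = r x' → ∃ n : G, (∀ y : E i₁, n • y = y) ∧ n • x = x') :
    Submodule.span ℚ (Set.range fun x : E i₁ => fun g : G => antiVec (Φ i₁) g x) ≤
        Submodule.span ℚ (Set.range fun x : E i₀ => fun g : G => antiVec (Φ i₀) g x) ↔
      Submodule.span ℚ (Set.range fun x : E i₁ => fun g : G => antiVec (Φ i₁) g x) ≤
        Submodule.span ℚ (Set.range fun y : Y₀ => fun g : G =>
          ∑ x ∈ Finset.univ.filter (fun x => r x = y), antiVec (Φ i₀) g x) := by
  constructor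
  · intro hle
    have hmeet := span_coeff_inf_eq_span_fibreSum_inf_span_coeff_of_fine Φ r hfine (i₁ := i₁)
    rw [inf_eq_right.2 hle] at hmeet
    exact (le_of_eq hmeet).trans inf_le_left
  · intro hle
    exact hle.trans (span_fibreSum_le_span_coeff (G := G) (Φ i₀) r)

/-- **DOMINATION ON A FINE EQUIVARIANT PIVOT: `rank(Φ₀,Φ₁) = rank Φ₀ ⟺ MC₁ ≤ S(w₀)`**, `S(w₀) = span{g ↦ w₀(g·y)}`
the coefficient space of the SHADOW `w₀ = r_* u₀` of `Φ₀` on `Y₀`. [cite: Gordon1999HodgeAVSurvey, §3 Theorem (proof),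
7.5–7.7 and 9.4.3] [cite: Deligne1982HodgeCycles, I.5 (p. 53)] -/
theorem typeRank_sigmaType_eq_typeRank_iff_span_coeff_le_span_shadowCoeff_of_fine [MulAction G Y₀] {ρ : G}
    {Φ : ∀ i, Set (E i)} (h : ∀ i, IsCMTypeWith ρ (Φ i)) {i₀ i₁ : I} (hI : ∀ j, j = i₀ ∨ j = i₁)
    (r : E i₀ → Y₀) (hr : ∀ (g : G) (x : E i₀), r (g • x) = g • r x)
    (hfine : ∀ x x' : E i₀, r x = r x' → ∃ n : G, (∀ y : E i₁, n • y = y) ∧ n • x = x') :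
    typeRank G (sigmaType Φ) = typeRank G (Φ i₀) ↔
      Submodule.span ℚ (Set.range fun x : E i₁ => fun g : G => antiVec (Φ i₁) g x) ≤
        Submodule.span ℚ (Set.range fun y : Y₀ => fun g : G =>
          ∑ x ∈ Finset.univ.filter (fun x => r x = g • y), antiVec (Φ i₀) (1 : G) x) := by
  rw [typeRank_sigmaType_eq_typeRank_iff_span_coeff_le_of_pair h hI,
    span_coeff_le_iff_le_span_fibreSum_of_fine Φ r hfine, span_fibreSum_eq_span_shadowCoeff (Φ i₀) r hr]

omit [Fintype I] [∀ i, Nonempty (E i)] in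
/-- **DOMINATION FORCES A FAITHFUL PIVOT**: for pivots `r₀`, `r₁` of BOTH slots refining the trace classes,
**`MC₁ ≤ MC₀ ⟺ F₁ = MC₁ ∧ F₁ ≤ F₀`** (`MC₀ ∩ MC₁ = F₀ ∩ F₁`, so a dominated `MC₁` is `≤ F₁ ≤ MC₁`).
[cite: Gordon1999HodgeAVSurvey, §3 Theorem (proof)] -/
theorem span_coeff_le_iff_of_fine_of_fine (Φ : ∀ i, Set (E i)) {i₀ i₁ : I} (r₀ : E i₀ → Y₀) (r₁ : E i₁ → Y₁)
    (hfine₀ : ∀ x x' : E i₀, r₀ x = r₀ x' → ∃ n : G, (∀ y : E i₁, n • y = y) ∧ n • x = x')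
    (hfine₁ : ∀ x x' : E i₁, r₁ x = r₁ x' → ∃ n : G, (∀ y : E i₀, n • y = y) ∧ n • x = x') :
    Submodule.span ℚ (Set.range fun x : E i₁ => fun g : G => antiVec (Φ i₁) g x) ≤
        Submodule.span ℚ (Set.range fun x : E i₀ => fun g : G => antiVec (Φ i₀) g x) ↔
      Submodule.span ℚ (Set.range fun y : Y₁ => fun g : G =>
            ∑ x ∈ Finset.univ.filter (fun x => r₁ x = y), antiVec (Φ i₁) g x) =
          Submodule.span ℚ (Set.range fun x : E i₁ => fun g : G => antiVec (Φ i₁) g x) ∧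
        Submodule.span ℚ (Set.range fun y : Y₁ => fun g : G =>
            ∑ x ∈ Finset.univ.filter (fun x => r₁ x = y), antiVec (Φ i₁) g x) ≤
          Submodule.span ℚ (Set.range fun y : Y₀ => fun g : G =>
            ∑ x ∈ Finset.univ.filter (fun x => r₀ x = y), antiVec (Φ i₀) g x) := by
  have hF₁ := span_fibreSum_le_span_coeff (G := G) (Φ i₁) r₁
  have hF₀ := span_fibreSum_le_span_coeff (G := G) (Φ i₀) r₀
  -- `MC₀ ∩ MC₁ = F₀ ∩ F₁` (P1 on both sides)
  have h0 := span_coeff_inf_eq_span_fibreSum_inf_span_coeff_of_fine Φ r₀ hfine₀ (i₁ := i₁)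
  have h1 := span_coeff_inf_eq_span_fibreSum_inf_span_coeff_of_fine Φ r₁ hfine₁ (i₁ := i₀)
  constructor
  · intro hle
    have hmeet : Submodule.span ℚ (Set.range fun x : E i₁ => fun g : G => antiVec (Φ i₁) g x) ≤
        Submodule.span ℚ (Set.range fun y : Y₀ => fun g : G =>
            ∑ x ∈ Finset.univ.filter (fun x => r₀ x = y), antiVec (Φ i₀) g x) ⊓
          Submodule.span ℚ (Set.range fun y : Y₁ => fun g : G =>
            ∑ x ∈ Finset.univ.filter (fun x => r₁ x = y), antiVec (Φ i₁) g x) := by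
      intro c hc
      have hc0 : c ∈ Submodule.span ℚ (Set.range fun x : E i₀ => fun g : G => antiVec (Φ i₀) g x) ⊓
          Submodule.span ℚ (Set.range fun x : E i₁ => fun g : G => antiVec (Φ i₁) g x) := ⟨hle hc, hc⟩
      have hc1 : c ∈ Submodule.span ℚ (Set.range fun x : E i₁ => fun g : G => antiVec (Φ i₁) g x) ⊓
          Submodule.span ℚ (Set.range fun x : E i₀ => fun g : G => antiVec (Φ i₀) g x) := ⟨hc, hle hc⟩
      rw [h0] at hc0
      rw [h1] at hc1
      exact ⟨hc0.1, hc1.1⟩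
    exact ⟨le_antisymm hF₁ (hmeet.trans inf_le_right), (le_of_eq_of_le rfl hF₁).trans (hmeet.trans inf_le_left)⟩
  · rintro ⟨heq, hle⟩
    rw [← heq]
    exact hle.trans hF₀

/-- **`rank(Φ₀,Φ₁) = rank Φ₀ ⟺ S(w₁) = MC₁ ∧ S(w₁) ≤ S(w₀)`** for equivariant pivots of both slots refining the trace
classes: a dominated slot loses no rank on its pivot (`dim S(w₁) = rank Φ₁ − 1`) and its shadow is absorbed.
[cite: Gordon1999HodgeAVSurvey, §3 Theorem (proof), 7.5–7.7 and 9.4.3] -/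
theorem typeRank_sigmaType_eq_typeRank_iff_of_fine_of_fine [MulAction G Y₀] [MulAction G Y₁] {ρ : G}
    {Φ : ∀ i, Set (E i)} (h : ∀ i, IsCMTypeWith ρ (Φ i)) {i₀ i₁ : I} (hI : ∀ j, j = i₀ ∨ j = i₁)
    (r₀ : E i₀ → Y₀) (r₁ : E i₁ → Y₁) (hr₀ : ∀ (g : G) (x : E i₀), r₀ (g • x) = g • r₀ x)
    (hr₁ : ∀ (g : G) (x : E i₁), r₁ (g • x) = g • r₁ x)
    (hfine₀ : ∀ x x' : E i₀, r₀ x = r₀ x' → ∃ n : G, (∀ y : E i₁, n • y = y) ∧ n • x = x')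
    (hfine₁ : ∀ x x' : E i₁, r₁ x = r₁ x' → ∃ n : G, (∀ y : E i₀, n • y = y) ∧ n • x = x') :
    typeRank G (sigmaType Φ) = typeRank G (Φ i₀) ↔
      Submodule.span ℚ (Set.range fun y : Y₁ => fun g : G =>
            ∑ x ∈ Finset.univ.filter (fun x => r₁ x = g • y), antiVec (Φ i₁) (1 : G) x) =
          Submodule.span ℚ (Set.range fun x : E i₁ => fun g : G => antiVec (Φ i₁) g x) ∧
        Submodule.span ℚ (Set.range fun y : Y₁ => fun g : G =>
            ∑ x ∈ Finset.univ.filter (fun x => r₁ x = g • y), antiVec (Φ i₁) (1 : G) x) ≤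
          Submodule.span ℚ (Set.range fun y : Y₀ => fun g : G =>
            ∑ x ∈ Finset.univ.filter (fun x => r₀ x = g • y), antiVec (Φ i₀) (1 : G) x) := by
  rw [typeRank_sigmaType_eq_typeRank_iff_span_coeff_le_of_pair h hI,
    span_coeff_le_iff_of_fine_of_fine Φ r₀ r₁ hfine₀ hfine₁, span_fibreSum_eq_span_shadowCoeff (Φ i₀) r₀ hr₀,
    span_fibreSum_eq_span_shadowCoeff (Φ i₁) r₁ hr₁]

end Pivot

/-! ### §3 In an isotypic class: domination over the commutant -/

section Class

variable {Y : Type vY} [MulAction G Y] [Fintype Y] {Y₀ : Type v'} [MulAction G Y₀] [Fintype Y₀]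

omit [∀ i, Fintype (E i)] [Fintype I] [∀ i, Nonempty (E i)] in
/-- The matrix-coefficient space of a slot is the shadow-coefficient space of its TYPE VECTOR on the Galois pivot:
`MC₁ = span{g ↦ u₁(g·x) : x}` with `u₁ = Σ_k ι_k(b′_k)`. [cite: Ribet1980, §3 (3.3)] -/
theorem span_coeff_eq_span_shadowCoeff_of_eq (Φ : ∀ i, Set (E i)) (i₁ : I) {u : E i₁ → ℚ}
    (hu : antiVec (Φ i₁) (1 : G) = u) :
    Submodule.span ℚ (Set.range fun x : E i₁ => fun g : G => antiVec (Φ i₁) g x) =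
      Submodule.span ℚ (Set.range fun x : E i₁ => fun g : G => u (g • x)) := by
  have hfun : (fun x : E i₁ => fun g : G => antiVec (Φ i₁) g x) = fun x : E i₁ => fun g : G => u (g • x) := by
    funext x g
    rw [antiVec_apply_eq_antiVec_one_smul, hu]
  rw [hfun]

/-- **HODGE DOMINATION OVER THE COMMUTANT.**  Two slots; `r₀ : E₀ → Y₀` an equivariant pivot refining the trace
classes; ONE reference stable irreducible `A ≤ ℚ^{Y}` with commutant `𝒟` (ANY) and equivariant embeddings `ι⁰_j`,
`ι¹_k` of `A` into `ℚ^{Y₀}`, `ℚ^{E₁}`, each family jointly independent on `A`, assembling the shadow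
`w₀ = Σ_j ι⁰_j(b_j)` of `Φ₀` on `Y₀` and the type vector `u₁ = Σ_k ι¹_k(b′_k)` of `Φ₁` itself (`A ≠ 0`).  Then
**`rank(Φ₀,Φ₁) = rank Φ₀ ⟺ D⟨b′⟩ ≤ D⟨b⟩`** — `A₁` is Hodge-dominated by `A₀` iff every component of `u₁` is a
`D`-combination of the components of `w₀` (file C6's absorption). [cite: Gordon1999HodgeAVSurvey, §3 Theorem (proof),
7.5–7.7 and 9.4.3] [cite: Lang2002, XVII §3] [cite: Deligne1982HodgeCycles, I.5 (p. 53)] -/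
theorem typeRank_sigmaType_eq_typeRank_iff_iSup_le_of_class {ρ : G} {Φ : ∀ i, Set (E i)}
    (h : ∀ i, IsCMTypeWith ρ (Φ i)) {i₀ i₁ : I} (hI : ∀ j, j = i₀ ∨ j = i₁)
    (r₀ : E i₀ → Y₀) (hr₀ : ∀ (g : G) (x : E i₀), r₀ (g • x) = g • r₀ x)
    (hfine₀ : ∀ x x' : E i₀, r₀ x = r₀ x' → ∃ n : G, (∀ y : E i₁, n • y = y) ∧ n • x = x')
    {A : Submodule ℚ (Y → ℚ)} {𝒟 : Submodule ℚ ((Y → ℚ) →ₗ[ℚ] (Y → ℚ))}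
    (h𝒟 : ∀ L : (Y → ℚ) →ₗ[ℚ] (Y → ℚ), L ∈ 𝒟 ↔ (∀ a ∈ A, L a ∈ A) ∧
      ∀ (k : G) (a : Y → ℚ), a ∈ A → L (fun y => a (k • y)) = fun y => L a (k • y))
    (hAst : ∀ (k : G) (a : Y → ℚ), a ∈ A → (fun y => a (k • y)) ∈ A)
    (hAirr : ∀ W : Submodule ℚ (Y → ℚ), W ≤ A → W ≠ ⊥ →
      (∀ (k : G) (f : Y → ℚ), f ∈ W → (fun y => f (k • y)) ∈ W) → W = A)
    (hA0 : A ≠ ⊥) {J₀ : Type u₀} {J₁ : Type u₁} [Fintype J₀] [Fintype J₁]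
    (ι₀ : J₀ → ((Y → ℚ) →ₗ[ℚ] (Y₀ → ℚ))) (ι₁ : J₁ → ((Y → ℚ) →ₗ[ℚ] (E i₁ → ℚ)))
    (hι₀eq : ∀ (j : J₀) (k : G) (a : Y → ℚ), a ∈ A → ι₀ j (fun y => a (k • y)) = fun y => ι₀ j a (k • y))
    (hι₁eq : ∀ (j : J₁) (k : G) (a : Y → ℚ), a ∈ A → ι₁ j (fun y => a (k • y)) = fun y => ι₁ j a (k • y))
    (hind₀ : ∀ f : J₀ → (Y → ℚ), (∀ j, f j ∈ A) → ∑ j, ι₀ j (f j) = 0 → ∀ j, f j = 0)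
    (hind₁ : ∀ f : J₁ → (Y → ℚ), (∀ j, f j ∈ A) → ∑ j, ι₁ j (f j) = 0 → ∀ j, f j = 0)
    {b₀ : J₀ → (Y → ℚ)} {b₁ : J₁ → (Y → ℚ)} (hb₀ : ∀ j, b₀ j ∈ A) (hb₁ : ∀ j, b₁ j ∈ A)
    (hw₀ : (fun y : Y₀ => ∑ x ∈ Finset.univ.filter (fun x => r₀ x = y), antiVec (Φ i₀) (1 : G) x) =
      ∑ j, ι₀ j (b₀ j))
    (hu₁ : antiVec (Φ i₁) (1 : G) = ∑ j, ι₁ j (b₁ j)) :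
    typeRank G (sigmaType Φ) = typeRank G (Φ i₀) ↔
      (⨆ j, 𝒟.map (LinearMap.applyₗ (b₁ j))) ≤ ⨆ j, 𝒟.map (LinearMap.applyₗ (b₀ j)) := by
  have e₀ : (fun (y : Y₀) (g : G) => ∑ x ∈ Finset.univ.filter (fun x => r₀ x = g • y), antiVec (Φ i₀) (1 : G) x) =
      fun (y : Y₀) (g : G) => (∑ j, ι₀ j (b₀ j)) (g • y) := by
    funext y g
    exact congrFun hw₀ (g • y)
  rw [typeRank_sigmaType_eq_typeRank_iff_span_coeff_le_span_shadowCoeff_of_fine h hI r₀ hr₀ hfine₀,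
    span_coeff_eq_span_shadowCoeff_of_eq Φ i₁ hu₁, e₀]
  exact span_shadowCoeff_le_iff_iSup_le h𝒟 hAst hAirr hA0 ι₀ ι₁ hι₀eq hι₁eq hind₀ hind₁ hb₀ hb₁

/-- **ONE COMPONENT PER SIDE: `rank(Φ₀,Φ₁) = rank Φ₀ ⟺ b′ ∈ D·b`** (`w₀ = ι⁰(b)`, `u₁ = ι¹(b′)` for single
equivariant embeddings injective on `A`; `A ≠ 0`): `A₁` is Hodge-dominated by `A₀` iff the component of its type
vector lies on the D-LINE of the component of the shadow of `Φ₀`. [cite: Gordon1999HodgeAVSurvey, §3 Theorem (proof),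
7.5–7.7] [cite: Lang2002, XVII §1 Prop. 1.1 and §3] -/
theorem typeRank_sigmaType_eq_typeRank_iff_mem_map_applyₗ_of_class {ρ : G} {Φ : ∀ i, Set (E i)}
    (h : ∀ i, IsCMTypeWith ρ (Φ i)) {i₀ i₁ : I} (hI : ∀ j, j = i₀ ∨ j = i₁)
    (r₀ : E i₀ → Y₀) (hr₀ : ∀ (g : G) (x : E i₀), r₀ (g • x) = g • r₀ x)
    (hfine₀ : ∀ x x' : E i₀, r₀ x = r₀ x' → ∃ n : G, (∀ y : E i₁, n • y = y) ∧ n • x = x')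
    {A : Submodule ℚ (Y → ℚ)} {𝒟 : Submodule ℚ ((Y → ℚ) →ₗ[ℚ] (Y → ℚ))}
    (h𝒟 : ∀ L : (Y → ℚ) →ₗ[ℚ] (Y → ℚ), L ∈ 𝒟 ↔ (∀ a ∈ A, L a ∈ A) ∧
      ∀ (k : G) (a : Y → ℚ), a ∈ A → L (fun y => a (k • y)) = fun y => L a (k • y))
    (hAst : ∀ (k : G) (a : Y → ℚ), a ∈ A → (fun y => a (k • y)) ∈ A)
    (hAirr : ∀ W : Submodule ℚ (Y → ℚ), W ≤ A → W ≠ ⊥ →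
      (∀ (k : G) (f : Y → ℚ), f ∈ W → (fun y => f (k • y)) ∈ W) → W = A)
    (hA0 : A ≠ ⊥) (ι₀ : (Y → ℚ) →ₗ[ℚ] (Y₀ → ℚ)) (ι₁ : (Y → ℚ) →ₗ[ℚ] (E i₁ → ℚ))
    (hι₀eq : ∀ (k : G) (a : Y → ℚ), a ∈ A → ι₀ (fun y => a (k • y)) = fun y => ι₀ a (k • y))
    (hι₁eq : ∀ (k : G) (a : Y → ℚ), a ∈ A → ι₁ (fun y => a (k • y)) = fun y => ι₁ a (k • y))
    (hinj₀ : ∀ f ∈ A, ι₀ f = 0 → f = 0) (hinj₁ : ∀ f ∈ A, ι₁ f = 0 → f = 0)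
    {b₀ b₁ : Y → ℚ} (hb₀ : b₀ ∈ A) (hb₁ : b₁ ∈ A)
    (hw₀ : (fun y : Y₀ => ∑ x ∈ Finset.univ.filter (fun x => r₀ x = y), antiVec (Φ i₀) (1 : G) x) = ι₀ b₀)
    (hu₁ : antiVec (Φ i₁) (1 : G) = ι₁ b₁) :
    typeRank G (sigmaType Φ) = typeRank G (Φ i₀) ↔ b₁ ∈ 𝒟.map (LinearMap.applyₗ b₀) := by
  have e₀ : (fun (y : Y₀) (g : G) => ∑ x ∈ Finset.univ.filter (fun x => r₀ x = g • y), antiVec (Φ i₀) (1 : G) x) =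
      fun (y : Y₀) (g : G) => ι₀ b₀ (g • y) := by
    funext y g
    exact congrFun hw₀ (g • y)
  rw [typeRank_sigmaType_eq_typeRank_iff_span_coeff_le_span_shadowCoeff_of_fine h hI r₀ hr₀ hfine₀,
    span_coeff_eq_span_shadowCoeff_of_eq Φ i₁ hu₁, e₀]
  exact span_shadowCoeff_le_iff_mem_single h𝒟 hAst hAirr hA0 ι₀ ι₁ hι₀eq hι₁eq hinj₀ hinj₁ hb₀ hb₁

/-- **THE EXCESS COUNT IN A CLASS: `rank(Φ₀,Φ₁)·δ + dim(D⟨b⟩ ∩ D⟨b′⟩)·dim A = rank Φ₀·δ + dim D⟨b′⟩·dim A`**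
(same setting, `0 ≠ a₀ ∈ A` names `δ`): `(dim Hg(A₀×A₁) − dim Hg(A₀))·δ = (dim D⟨b′⟩ − dim(D⟨b⟩ ∩ D⟨b′⟩))·dim A` — the
excess counts the D-dimension of the components of `u₁` modulo those of `w₀` (file C4's two counts in §1's excess).
[cite: Gordon1999HodgeAVSurvey, §3 Theorem (proof), 7.5–7.7 and 9.4.3] [cite: Lang2002, XVII §3] -/
theorem typeRank_sigmaType_mul_add_eq_of_class {ρ : G} {Φ : ∀ i, Set (E i)}
    (h : ∀ i, IsCMTypeWith ρ (Φ i)) {i₀ i₁ : I} (hI : ∀ j, j = i₀ ∨ j = i₁) (h01 : i₀ ≠ i₁)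
    (r₀ : E i₀ → Y₀) (hr₀ : ∀ (g : G) (x : E i₀), r₀ (g • x) = g • r₀ x)
    (hfine₀ : ∀ x x' : E i₀, r₀ x = r₀ x' → ∃ n : G, (∀ y : E i₁, n • y = y) ∧ n • x = x')
    {A : Submodule ℚ (Y → ℚ)} {𝒟 : Submodule ℚ ((Y → ℚ) →ₗ[ℚ] (Y → ℚ))}
    (h𝒟 : ∀ L : (Y → ℚ) →ₗ[ℚ] (Y → ℚ), L ∈ 𝒟 ↔ (∀ a ∈ A, L a ∈ A) ∧
      ∀ (k : G) (a : Y → ℚ), a ∈ A → L (fun y => a (k • y)) = fun y => L a (k • y))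
    (hAst : ∀ (k : G) (a : Y → ℚ), a ∈ A → (fun y => a (k • y)) ∈ A)
    (hAirr : ∀ W : Submodule ℚ (Y → ℚ), W ≤ A → W ≠ ⊥ →
      (∀ (k : G) (f : Y → ℚ), f ∈ W → (fun y => f (k • y)) ∈ W) → W = A)
    {J₀ : Type u₀} {J₁ : Type u₁} [Fintype J₀] [Fintype J₁]
    (ι₀ : J₀ → ((Y → ℚ) →ₗ[ℚ] (Y₀ → ℚ))) (ι₁ : J₁ → ((Y → ℚ) →ₗ[ℚ] (E i₁ → ℚ)))
    (hι₀eq : ∀ (j : J₀) (k : G) (a : Y → ℚ), a ∈ A → ι₀ j (fun y => a (k • y)) = fun y => ι₀ j a (k • y))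
    (hι₁eq : ∀ (j : J₁) (k : G) (a : Y → ℚ), a ∈ A → ι₁ j (fun y => a (k • y)) = fun y => ι₁ j a (k • y))
    (hind₀ : ∀ f : J₀ → (Y → ℚ), (∀ j, f j ∈ A) → ∑ j, ι₀ j (f j) = 0 → ∀ j, f j = 0)
    (hind₁ : ∀ f : J₁ → (Y → ℚ), (∀ j, f j ∈ A) → ∑ j, ι₁ j (f j) = 0 → ∀ j, f j = 0)
    {b₀ : J₀ → (Y → ℚ)} {b₁ : J₁ → (Y → ℚ)} (hb₀ : ∀ j, b₀ j ∈ A) (hb₁ : ∀ j, b₁ j ∈ A)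
    (hw₀ : (fun y : Y₀ => ∑ x ∈ Finset.univ.filter (fun x => r₀ x = y), antiVec (Φ i₀) (1 : G) x) =
      ∑ j, ι₀ j (b₀ j))
    (hu₁ : antiVec (Φ i₁) (1 : G) = ∑ j, ι₁ j (b₁ j)) {a₀ : Y → ℚ} (ha₀ : a₀ ∈ A) (h0 : a₀ ≠ 0) :
    typeRank G (sigmaType Φ) * Module.finrank ℚ ↥(𝒟.map (LinearMap.applyₗ a₀)) +
        Module.finrank ℚ ↥((⨆ j, 𝒟.map (LinearMap.applyₗ (b₀ j))) ⊓ ⨆ j, 𝒟.map (LinearMap.applyₗ (b₁ j))) *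
          Module.finrank ℚ A =
      typeRank G (Φ i₀) * Module.finrank ℚ ↥(𝒟.map (LinearMap.applyₗ a₀)) +
        Module.finrank ℚ ↥(⨆ j, 𝒟.map (LinearMap.applyₗ (b₁ j))) * Module.finrank ℚ A := by
  have hexc := typeRank_sigmaType_add_finrank_inf_eq_of_pair h hI h01
  have e₀ : (fun (y : Y₀) (g : G) => ∑ x ∈ Finset.univ.filter (fun x => r₀ x = g • y), antiVec (Φ i₀) (1 : G) x) =
      fun (y : Y₀) (g : G) => (∑ j, ι₀ j (b₀ j)) (g • y) := by
    funext y g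
    exact congrFun hw₀ (g • y)
  rw [span_coeff_inf_eq_span_fibreSum_inf_span_coeff_of_fine Φ r₀ hfine₀,
    span_fibreSum_eq_span_shadowCoeff (Φ i₀) r₀ hr₀, span_coeff_eq_span_shadowCoeff_of_eq Φ i₁ hu₁, e₀] at hexc
  have hmeet := finrank_span_shadowCoeff_inf_mul_eq (Y₁ := E i₁) h𝒟 hAst hAirr ι₀ ι₁ hι₀eq hι₁eq hind₀ hind₁ hb₀
    hb₁ ha₀ h0
  have hone := finrank_span_shadowCoeff_sum_mul_eq (Y₀ := E i₁) h𝒟 hAst hAirr ι₁ hι₁eq hind₁ hb₁ ha₀ h0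
  have key := congrArg (· * Module.finrank ℚ ↥(𝒟.map (LinearMap.applyₗ a₀))) hexc
  simp only [add_mul] at key
  rw [hmeet, hone] at key
  exact key

end Class

end Summit.HodgeConjecture.CorCM.IrrOdd

end
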